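import Summits.QuantumFields.YangMills.Theorems.UnitScaleTiltProp8HalvingSliceDictionary
import Summits.QuantumFields.YangMills.Theorems.UnitScaleTiltProp8FlatCubeOpsText
import HarnessLib

/-!
# Route `UnitScaleTilt`, crux K1 child «MinimiserStabilityRegPr» (stmt-QuantumFields-19200), registered stub V2′ `stub_halvingStep`
# (skeletons v8 5b4e846794b80374 ∕ v10 `BirthV10`) — **THE F2↔P2 DICTIONARY FOR THE (152) SIZES: [B8] (1.36) SUP AND GRADIENT LETTERS ON THE
# PERIODIC PULLBACK OVER THE DOMAIN TOWER ⟹ THE LEVEL-WEIGHTED SIZE ROWS `w 1 b‖A b‖ ≤ δ`, `w 2 b·L^{K−n}‖A⟨b₋+e_ν,dir b⟩ − A b‖ ≤ δ′` OF THE F4 PEN**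
# (owner W-SEAT MAP #3 row M3 ∕ ASSIGNMENTS 9 (b) 05:01:42Z; completes the Literature-letter dischargeability of the displayed P1 hypothesis of
# ✓ p607414 `HalvingChartP1Display.package_rows_of_P1disp`: (153) = ✓ p607449 `HalvingSliceDictionary`, (152) = THIS FILE)

Cell `ym3-torus` (HUMAN RULING D-0037, YM ladder rung R3 — continuum SU(2) YM₃ on the torus is a RUNG, not the Clay problem), width seat
`ym-ust-19200-w7` gen 0 (D-0154 (3c)).  `--supports stmt-QuantumFields-19200 --as helper`; def-free, 0 sorry, standard axioms.

WHY.  The displayed pillar P1 of ✓ p607414 carries the (152) sizes of the Thm-2 log field `A` in the F4 pen's letters — `∀ b, w 1 b·‖A b‖ ≤ δ` and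
`∀ b ν, w 2 b·L^{K−n}·‖A⟨b₋+e_ν, dir b⟩ − A b‖ ≤ δ′` with the LEVEL WEIGHTS `w m b = (L^{j(b₋)}η)^m`, `η = L^{−(K−n)}`, `j(x) = levOf {Ω_j} (K−n) x`
(`FlatCubeOpsText.IsLevWeight`) — while [Balaban1985RegularSpaces] Theorem 2 prints (1.36) p. 82 *«|A| < B₁(α₀ + α₁)(Lʲη)⁻¹, |∇^η_{U₀}A| <
B₁(α₀ + α₁)(Lʲη)⁻², … on Ω_j, j = 0, 1, …, k»* ( = [Balaban1985Variational] (152) p. 301 for the cube sequence), which the Literature's `ℤᵈ` lineage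
types LEVEL BY LEVEL on the bonds touching `Ω_j` (`B8Thm2TorusAt.C136T`, `B8LeafModelZd3.zdGF3.C136`: `SideTouches (Ω j)`-bonds, the sup member on
`A♯`, the gradient member on the forward covariant derivatives `covDerivFwd η U₀ μ (A♯ · κ)`).  THIS FILE is the dictionary at `U₀ = 1` on the periodic
pullback `A♯ = pull A 0` over the pulled-back tower `pullDom (j ↦ Ω_j)` of ANY nested family `D` (in particular the cube sequence `cubeSeqMT3`): the two
level-by-level letters imply the two weighted rows, because every fine bond `b` touches the domain `Ω_{j(b₋)}` of its own level (`B11Eq115Space.mem_levOf`).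

WHAT THIS FILE PROVES (d = 3 carrier `F.P K`, every `D : Domains (F.P K)`, `M₂(ℂ)`-valued `A`; no definition, no sorry):
* §1 `inOm_levOf` (`b₋ ∈ Ω_{j(b₋)}`), `levOf_le_top`, `sideTouches_pullDom_levOf` (the bond `⟨labels b₋, dir b⟩` side-touches `pullDom Ω j(b₋)`),
  `levWeight_pos` (`0 < Lʲη`).
* §2 ★★ **`size152_sup_of_pullLetter`** — `(∀ j ≤ K−n, ∀ z μ, SideTouches (pullDom Ω j) z μ → ‖A♯ z μ‖ ≤ δ·(Lʲη)⁻¹) ⟹ ∀ b, w 1 b·‖A b‖ ≤ δ`;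
  ★★ **`size152_grad_of_pullLetter`** — `(∀ j ≤ K−n, ∀ z ν μ, SideTouches (pullDom Ω j) z μ → ‖covDerivFwd η 1 ν (A♯ · μ) z‖ ≤ δ′·((Lʲη)⁻¹)²) ⟹
  ∀ b ν, w 2 b·L^{K−n}·‖A⟨b₋+e_ν, dir b⟩ − A b‖ ≤ δ′` — EXACTLY the `hA₀`∕`hA₁` inputs of ✓ `HalvingSize152OfChart.size152_bond` and the third∕fourth
  conjuncts of the displayed `hP1` of `HalvingChartP1Display.package_rows_of_P1disp` (with `Ω j := {x | D.InOm j x}`).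
HONEST SCOPE.  Bookkeeping (`levOf`, the flat forward derivative `Prop8PullbackDict.covDerivFwd_flat_pull_apply`, the labels section
`HalvingSliceDictionary.transl_zero_valLabels`); the letters themselves ([B8] Thm 2 ∕ (1.36) at the cube member, pillar P1) are hypotheses; strictness `<` of print is
relaxed to `≤` on the input side (weaker hypothesis).  NOT a claim about the stub, the crux, the rung or the mass gap.

References: T. Bałaban, CMP **99** (1985) 75–102 [Balaban1985RegularSpaces] (1.1) p.76, (1.3)–(1.5) p.77, (1.36) p.82, Thm 2 p.83; CMP **102** (1985) 277–309
[Balaban1985Variational] p.286 (the norms `|·|_j`), (115) p.294, (152) p.301.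
-/

set_option autoImplicit false

noncomputable section

open scoped BigOperators Matrix.Norms.L2Operator

namespace Summit.QuantumFields.YangMills.Theorems.HalvingSize152Dictionary

open Literature.MathematicalPhysics.QuantumFieldTheory.Balaban1983to89
open B6SectADomainsV1 (Domains)
open B8Ineq132 (covDerivFwd BondTouches)
open B8Eq140Level (SideTouches sideTouches_of_bondTouches)
open B8Thm2SetupTorus (pullDom mem_pullSet)
open B10Eq27TorusAxialLog (pull transl pull_apply)
open B11Eq115Space (levOf levOf_le mem_levOf)
open T3ContinuumYM3Torus (T3Family)
open FlatCubeOpsText (IsLevWeight)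
open Prop8PullbackDict (covDerivFwd_flat_pull_apply)
open HalvingSliceDictionary (transl_zero_valLabels)

variable {F : T3Family} {n K : ℕ}

/-! ## §1 Every fine bond touches the domain of its own level -/

section Level

/-- **`b₋ ∈ Ω_{j(b₋)}`**: a fine site lies in the domain of its level `j(x) = levOf {Ω_j} (K−n) x` (`Ω₀ = T`). [cite: Balaban1985Variational, p.286, (115) p.294; Balaban1984PropagatorsII, (2.1) p.224] -/
theorem inOm_levOf (D : Domains (F.P K)) (x : Site (F.P K) 0) :
    D.InOm (levOf (fun j => {y : Site (F.P K) 0 | D.InOm j y}) (K - n) x) x := by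
  have htop : ∀ y : Site (F.P K) 0, y ∈ ({y : Site (F.P K) 0 | D.InOm 0 y} : Set (Site (F.P K) 0)) := by
    intro y
    show B5Eq118OneStroke.iterBlockOf 0 y ∈ D.Om 0
    rw [D.Om_zero]; exact Finset.mem_univ _
  exact mem_levOf (Ω := fun j => {y : Site (F.P K) 0 | D.InOm j y}) htop (K - n) x

/-- **THE BOND `⟨labels b₋, dir b⟩` SIDE-TOUCHES THE PULLED-BACK DOMAIN OF ITS LEVEL** (its source lies in it; `d = 3 ≥ 2` supplies the second direction).
[cite: Balaban1985RegularSpaces, p.77 (convention before (1.5)), (1.3) p.77] -/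
theorem sideTouches_pullDom_levOf (D : Domains (F.P K)) (b : PBond (F.P K) 0) :
    SideTouches (pullDom (fun j => {y : Site (F.P K) 0 | D.InOm j y}) (levOf (fun j => {y : Site (F.P K) 0 | D.InOm j y}) (K - n) b.src))
      (fun ν => ((b.src ν).val : ℤ)) b.dir := by
  obtain ⟨κ, hκ⟩ : ∃ κ : Fin (F.P K).d, κ ≠ b.dir := by
    haveI : Nontrivial (Fin (F.P K).d) := (inferInstance : Nontrivial (Fin 3))
    exact exists_ne b.dir
  refine sideTouches_of_bondTouches hκ (Or.inl ?_)
  show transl (0 : Site (F.P K) 0) (fun ν => ((b.src ν).val : ℤ)) ∈ {y : Site (F.P K) 0 | D.InOm _ y}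
  rw [transl_zero_valLabels]
  exact inOm_levOf D b.src

/-- `0 < Lʲη`. [folklore] -/
theorem levWeight_pos (j : ℕ) : 0 < (F.L : ℝ) ^ j * ((F.L : ℝ)⁻¹) ^ (K - n) := by
  have hL : 0 < (F.L : ℝ) := Nat.cast_pos.2 (F.P K).L_pos
  positivity

end Level

/-! ## §2 The two (152) rows from the level-by-level letters on the pullback -/

section Rows

/-- ★★ **THE SUP ROW OF (152) FROM THE (1.36) SUP LETTER ON THE PULLBACK**: if on every bond side-touching `pullDom Ω j`, `j ≤ K−n`, the pullback has
`‖A♯ z μ‖ ≤ δ·(Lʲη)⁻¹` (`η = L^{−(K−n)}`, `Ω j = {x | x ∈ Bʲ(Ω_j^{(j)})}`), then `w 1 b·‖A b‖ ≤ δ` at every fine bond for the level weights `w` of the F4 pen — the `hA₀`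
of `HalvingSize152OfChart.size152_bond` ∕ the third conjunct of `HalvingChartP1Display.package_rows_of_P1disp`'s `hP1`.
[cite: Balaban1985RegularSpaces, (1.36) p.82, Thm 2 p.83; Balaban1985Variational, (152) p.301, p.286] -/
theorem size152_sup_of_pullLetter (D : Domains (F.P K)) {w : ℕ → PBond (F.P K) 0 → ℝ} (hw : IsLevWeight F n K D w)
    {A : PBond (F.P K) 0 → Matrix (Fin 2) (Fin 2) ℂ} {δ : ℝ}
    (hsup : ∀ j, j ≤ K - n → ∀ (z : B7Prop1Explicit.Site (F.P K).d) (μ : Fin (F.P K).d),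
      SideTouches (pullDom (fun j => {y : Site (F.P K) 0 | D.InOm j y}) j) z μ →
        ‖pull A 0 z μ‖ ≤ δ * ((F.L : ℝ) ^ j * ((F.L : ℝ)⁻¹) ^ (K - n))⁻¹) :
    ∀ b : PBond (F.P K) 0, w 1 b * ‖A b‖ ≤ δ := by
  intro b
  set j := levOf (fun j => {y : Site (F.P K) 0 | D.InOm j y}) (K - n) b.src with hj
  have hjk : j ≤ K - n := levOf_le _ _ _
  have h := hsup j hjk (fun ν => ((b.src ν).val : ℤ)) b.dir (sideTouches_pullDom_levOf D b)
  rw [pull_apply, transl_zero_valLabels] at h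
  have hpos := levWeight_pos (F := F) (n := n) (K := K) j
  rw [hw 1 b, pow_one, ← hj]
  calc (F.L : ℝ) ^ j * ((F.L : ℝ)⁻¹) ^ (K - n) * ‖A b‖
      ≤ (F.L : ℝ) ^ j * ((F.L : ℝ)⁻¹) ^ (K - n) * (δ * ((F.L : ℝ) ^ j * ((F.L : ℝ)⁻¹) ^ (K - n))⁻¹) :=
        mul_le_mul_of_nonneg_left h hpos.le
    _ = δ := by rw [mul_left_comm, mul_inv_cancel₀ hpos.ne', mul_one]

/-- ★★ **THE GRADIENT ROW OF (152) FROM THE (1.36) GRADIENT LETTER ON THE PULLBACK**: if on every bond `(z, μ)` side-touching `pullDom Ω j`, `j ≤ K−n`, and every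
direction `ν`, `‖(∇^η_{1,ν}A♯_μ)(z)‖ ≤ δ′·((Lʲη)⁻¹)²`, then `w 2 b·L^{K−n}·‖A⟨b₋+e_ν, dir b⟩ − A b‖ ≤ δ′` at every fine bond and direction — the `hA₁` of
`HalvingSize152OfChart.size152_bond` ∕ the fourth conjunct of the displayed `hP1`. [cite: Balaban1985RegularSpaces, (1.1) p.76, (1.36) p.82, Thm 2 p.83; Balaban1985Variational, (152) p.301] -/
theorem size152_grad_of_pullLetter (D : Domains (F.P K)) {w : ℕ → PBond (F.P K) 0 → ℝ} (hw : IsLevWeight F n K D w)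
    {A : PBond (F.P K) 0 → Matrix (Fin 2) (Fin 2) ℂ} {δ' : ℝ}
    (hgrad : ∀ j, j ≤ K - n → ∀ (z : B7Prop1Explicit.Site (F.P K).d) (ν μ : Fin (F.P K).d),
      SideTouches (pullDom (fun j => {y : Site (F.P K) 0 | D.InOm j y}) j) z μ →
        ‖covDerivFwd (((F.L : ℝ)⁻¹) ^ (K - n)) (1 : B7Prop1Explicit.Site (F.P K).d → Fin (F.P K).d → (Matrix (Fin 2) (Fin 2) ℂ)ˣ) ν
            (fun x => pull A 0 x μ) z‖ ≤ δ' * (((F.L : ℝ) ^ j * ((F.L : ℝ)⁻¹) ^ (K - n))⁻¹) ^ 2) :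
    ∀ (b : PBond (F.P K) 0) (ν : Fin (F.P K).d), w 2 b * (F.L : ℝ) ^ (K - n) * ‖A ⟨b.src.shift ν, b.dir⟩ - A b‖ ≤ δ' := by
  intro b ν
  set j := levOf (fun j => {y : Site (F.P K) 0 | D.InOm j y}) (K - n) b.src with hj
  have hjk : j ≤ K - n := levOf_le _ _ _
  have h := hgrad j hjk (fun κ => ((b.src κ).val : ℤ)) ν b.dir (sideTouches_pullDom_levOf D b)
  have hη : ‖((((F.L : ℝ)⁻¹) ^ (K - n))⁻¹ : ℝ)‖ = (F.L : ℝ) ^ (K - n) := by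
    rw [inv_pow, inv_inv, norm_pow, Real.norm_of_nonneg (Nat.cast_nonneg _)]
  rw [covDerivFwd_flat_pull_apply, transl_zero_valLabels, norm_smul, hη] at h
  -- `h : L^{K−n}·‖A⟨b₋+e_ν, dir b⟩ − A b‖ ≤ δ′·((Lʲη)⁻¹)²`
  have hpos := levWeight_pos (F := F) (n := n) (K := K) j
  have hb : (⟨b.src, b.dir⟩ : PBond (F.P K) 0) = b := rfl
  rw [hb] at h
  rw [hw 2 b, ← hj]
  calc ((F.L : ℝ) ^ j * ((F.L : ℝ)⁻¹) ^ (K - n)) ^ 2 * (F.L : ℝ) ^ (K - n) * ‖A ⟨b.src.shift ν, b.dir⟩ - A b‖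
      = ((F.L : ℝ) ^ j * ((F.L : ℝ)⁻¹) ^ (K - n)) ^ 2 * ((F.L : ℝ) ^ (K - n) * ‖A ⟨b.src.shift ν, b.dir⟩ - A b‖) := by ring
    _ ≤ ((F.L : ℝ) ^ j * ((F.L : ℝ)⁻¹) ^ (K - n)) ^ 2 * (δ' * (((F.L : ℝ) ^ j * ((F.L : ℝ)⁻¹) ^ (K - n))⁻¹) ^ 2) :=
        mul_le_mul_of_nonneg_left h (by positivity)
    _ = δ' := by
        have key : ∀ W t : ℝ, W ≠ 0 → W ^ 2 * (t * W⁻¹ ^ 2) = t := by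
          intro W t hW
          rw [inv_pow, mul_left_comm, mul_inv_cancel₀ (pow_ne_zero 2 hW), mul_one]
        exact key _ _ hpos.ne'

end Rows

end Summit.QuantumFields.YangMills.Theorems.HalvingSize152Dictionary

end
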